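import Mathlib
import Literature.NumberTheory.LFunctions.MatomakiRadziwillTaoTheorem13Proofs
import Summits.QuantumAdvantage.QuantumAdvantage.Theorems.MobiusLadderDigitPolyUniformityMRTWindowIntegral
import Summits.QuantumAdvantage.QuantumAdvantage.Theorems.MobiusLadderDigitPolyUniformityMRTWindowAverage
import Summits.QuantumAdvantage.QuantumAdvantage.Theorems.MobiusLadderQuadraticDigitPhasesStubMomoAPBlocks
import HarnessLib

/-!
# `DigitPolyUniformity` (stmt-QuantumAdvantage-1392), line `Sketch` — stub `stub_alignedMRT`
# (Matomäki–Radziwiłł–Tao 2015, Theorem 1.3, on ALIGNED dyadic blocks)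

Crux `Summit.QuantumAdvantage.QuantumAdvantage.Theses.MobiusLadder.DigitPolyUniformity` (route
`MobiusLadder`); line `Sketch`, skeleton `Cruxes/DigitPolyUniformity/Lines/SketchLAR.lean`, cycle 5 (seat c5:
the Matomäki–Radziwiłł–Tao classes). This file proves the registered stub

  `stub_alignedMRT : ∀ ε > 0, ∃ h₀, ∀ᶠ n, ∀ h, h₀ ≤ h → 2h ≤ n → ∀ α : ℝ,
     Σ_{y < 2^{n−h}} ‖Σ_{x < 2^h} λ(2^h y + x) e(α (2^h y + x))‖ ≤ ε 2ⁿ`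

— the Liouville function twisted by ANY linear phase `e(α·)` has cancellation in almost all ALIGNED dyadic
blocks `[2^h y, 2^h (y+1))` of every length `2^h ≥ 2^{h₀(ε)}` up to `2^{n/2}`, uniformly in `α` and `h`.

## Proof

THE INPUT is Matomäki–Radziwiłł–Tao 2015, Theorem 1.3, PROVED in the tree (standard axioms):
`Literature.NumberTheory.LFunctions.Tao2016.MatomakiRadziwillTao2015_theorem13_holds :
  ∃ C, ∀ H X : ℝ, 10 ≤ H → H ≤ X → ∀ α, ∫ x in 0..X, ‖Σ_{n ∈ Icc ⌈x⌉₊ ⌊x+H⌋₊} λ(n) e(αn)‖ ≤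
    C (log log H / log H + 1 / log^{1/700} X) H X`.
With `c(n) = λ(n) e(αn)` (`1`-bounded), `H = 2^h`, `Y = 2^{n−h}`, `X = HY = 2ⁿ`:
* the MRT integral is the discrete sum `Σ_{a=1}^{X} ‖Σ_{[a,a+H)} c‖` over integer left end-points
  (`stub_integral_window_eq_sum`, landed: `Theorems/…MRTWindowIntegral`);
* the aligned blocks are controlled by all windows, `Σ_{1≤y<Y} ‖Σ_{[Hy,Hy+H)} c‖ ≤ T⁻¹ Σ_a ‖…‖ + T Y` for any
  `0 < T ≤ H`, by `2`-Lipschitz sliding (`stub_window_average`, landed: `Theorems/…MRTWindowAverage`);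
* with `M = ⌈8/ε⌉ + 1`, `T = ⌊H/M⌋`, `η = ε/(16 M C')` (`C' = max C 1`), `h₀ = max(h₁(η), 4, M+1)` where
  `log log 2^h / log 2^h ≤ η` for `h ≥ h₁` and `1/ log^{1/700} 2ⁿ ≤ η` eventually: the block `y = 0` is `≤ H ≤ εX/16`
  (`H² ≤ X`, `H ≥ 16/ε`), the main term is `≤ T⁻¹ C'·2η·H X ≤ 4 M C' η X = εX/4`, the averaging error is
  `T Y ≤ X/M ≤ εX/8` (`AlignedMRT.final_bound`).

No unproved fact is used. (The sibling crux stmt-1391's line has the block lemma `liouville_phase_blocks` of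
`Theorems/MobiusLadderQuadraticDigitPhasesStubMomoAPBlocks.lean` — MRT Thm 1.3 as a hypothesis, `∀ᶠ k, ∀ᶠ n` —
from which we reuse `norm_liouville_mul_e_le`; the present statement is unconditional and uniform in the depth
`h ∈ [h₀, n/2]`, which the top-digit classes need.)
-/

noncomputable section

namespace Summit.QuantumAdvantage.DigitPolyUniformity.SketchLAR

open Filter Finset Real
open Literature.NumberTheory.LFunctions
open Summit.QuantumAdvantage.QuantumAdvantage.Theorems.MobiusLadderQuadraticDigitPhasesStubMomoAPBlocks
  (norm_liouville_mul_e_le)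

namespace AlignedMRT

/-- A block sum of `H` terms of a `1`-bounded sequence has norm at most `H`. [folklore] -/
theorem norm_sum_Ico_le_length {c : ℕ → ℂ} (hc : ∀ n, ‖c n‖ ≤ 1) (a H : ℕ) :
    ‖∑ n ∈ Ico a (a + H), c n‖ ≤ H := by
  refine (norm_sum_le _ _).trans ?_
  refine le_trans (Finset.sum_le_sum fun n _ => hc n) ?_
  simp

/-- `log log H / log H → 0` along `H = 2^h`: for every `η > 0` there is `h₁` with
`log (log 2^h) / log 2^h ≤ η` for all `h ≥ h₁`. [folklore] -/
theorem exists_loglog_div_log_le {η : ℝ} (hη : 0 < η) :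
    ∃ h₁ : ℕ, ∀ h : ℕ, h₁ ≤ h → Real.log (Real.log ((2 : ℝ) ^ h)) / Real.log ((2 : ℝ) ^ h) ≤ η := by
  have T1 : Tendsto (fun u : ℝ => Real.log u / u) atTop (nhds 0) := by
    simpa using Real.tendsto_pow_log_div_mul_add_atTop 1 0 1 one_ne_zero
  have T2 : Tendsto (fun h : ℕ => Real.log ((2 : ℝ) ^ h)) atTop atTop := by
    simp_rw [Real.log_pow]
    exact tendsto_natCast_atTop_atTop.atTop_mul_const (Real.log_pos one_lt_two)
  have T3 := (T1.comp T2).eventually (Iic_mem_nhds hη)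
  obtain ⟨h₁, hh₁⟩ := Filter.eventually_atTop.1 T3
  exact ⟨h₁, fun h hh => hh₁ h hh⟩

/-- `1 / (log 2^n)^{1/700} → 0`: eventually in `n`, `1 / (log 2^n)^{1/700} ≤ η`. [folklore] -/
theorem eventually_inv_log_rpow_le {η : ℝ} (hη : 0 < η) :
    ∀ᶠ n : ℕ in atTop, 1 / Real.log ((2 : ℝ) ^ n) ^ (1 / 700 : ℝ) ≤ η := by
  have T1 : Tendsto (fun u : ℝ => u ^ (-(1 / 700 : ℝ))) atTop (nhds 0) :=
    tendsto_rpow_neg_atTop (by norm_num)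
  have T2 : Tendsto (fun n : ℕ => Real.log ((2 : ℝ) ^ n)) atTop atTop := by
    simp_rw [Real.log_pow]
    exact tendsto_natCast_atTop_atTop.atTop_mul_const (Real.log_pos one_lt_two)
  have T3 := (T1.comp T2).eventually (Iic_mem_nhds hη)
  filter_upwards [T3] with n hn
  simp only [Function.comp_apply] at hn
  have hlog : 0 ≤ Real.log ((2 : ℝ) ^ n) := by
    rw [Real.log_pow]; exact mul_nonneg (Nat.cast_nonneg _) (Real.log_nonneg one_le_two)
  rw [one_div, ← Real.rpow_neg hlog]
  exact hn

/-- The real-number bookkeeping of `stub_alignedMRT`: with `M ≥ 8/ε`, `T = ⌊H/M⌋` (so `TM ≤ H ≤ MT + M`),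
`2M ≤ H`, `H² ≤ X = HY`, `η = ε/(16 M C')`, `0 ≤ δ ≤ 2η`, the three pieces — the block `y = 0` (`≤ H`), the
aligned blocks (`≤ T⁻¹ I + T Y`) and the MRT bound `I ≤ C' δ H X` — add up to at most `ε X`. [folklore] -/
theorem final_bound {ε C' M H T Y X δ η S I B₀ : ℝ} (hε : 0 < ε) (hC' : 1 ≤ C') (hM0 : 0 < M)
    (hM8 : 8 / ε ≤ M) (hH0 : 0 < H) (hT0 : 0 < T) (hTup : T * M ≤ H) (hTlow : H ≤ M * T + M)
    (hH2M : 2 * M ≤ H) (hHsq : H * H ≤ X) (hXHY : X = H * Y) (hY0 : 0 ≤ Y)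
    (hη : η = ε / (16 * M * C')) (hδ0 : 0 ≤ δ) (hδ : δ ≤ 2 * η)
    (h0 : B₀ ≤ H) (h2 : S ≤ 1 / T * I + T * Y) (h4 : I ≤ C' * δ * H * X) :
    B₀ + S ≤ ε * X := by
  have hX0 : 0 ≤ X := le_trans (by positivity) hHsq
  have hC'0 : 0 < C' := by linarith
  -- (i) the block `y = 0`
  have hi : H ≤ ε / 16 * X := by
    have h16 : 16 ≤ H * ε := by
      have : 16 / ε ≤ H := by
        have : 16 / ε = 2 * (8 / ε) := by ring
        linarith
      rwa [div_le_iff₀ hε] at this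
    nlinarith [mul_le_mul_of_nonneg_left hHsq hε.le, mul_le_mul_of_nonneg_right h16 hH0.le]
  -- (ii) the main term
  have hii : 1 / T * I ≤ ε / 4 * X := by
    have hTinv : 1 / T ≤ 2 * M / H := by
      rw [div_le_div_iff₀ hT0 hH0]
      linarith
    have hI0 : 1 / T * I ≤ 1 / T * (C' * δ * H * X) :=
      mul_le_mul_of_nonneg_left h4 (by positivity)
    calc 1 / T * I ≤ 1 / T * (C' * δ * H * X) := hI0
      _ ≤ (2 * M / H) * (C' * δ * H * X) := mul_le_mul_of_nonneg_right hTinv (by positivity)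
      _ = 2 * M * C' * δ * X := by field_simp
      _ ≤ 2 * M * C' * (2 * η) * X := by gcongr
      _ = ε / 4 * X := by rw [hη]; field_simp; ring
  -- (iii) the averaging error
  have hiii : T * Y ≤ ε / 8 * X := by
    have hMε : 1 / M ≤ ε / 8 := by
      rw [div_le_div_iff₀ hM0 (by norm_num : (0 : ℝ) < 8)]
      rw [div_le_iff₀ hε] at hM8
      linarith
    have h1 : T * Y * M ≤ X := by
      calc T * Y * M = T * M * Y := by ring
        _ ≤ H * Y := mul_le_mul_of_nonneg_right hTup hY0
        _ = X := hXHY.symm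
    have h2 : T * Y ≤ X * (1 / M) := by
      rw [mul_one_div, le_div_iff₀ hM0]; exact h1
    calc T * Y ≤ X * (1 / M) := h2
      _ ≤ X * (ε / 8) := by gcongr
      _ = ε / 8 * X := by ring
  nlinarith [mul_nonneg hε.le hX0]

end AlignedMRT

open AlignedMRT in
/-- **Stub (c5/S1, lead): aligned Matomäki–Radziwiłł–Tao.** For every `ε > 0` there is a depth `h₀` such
that, eventually in `n`, for every `h₀ ≤ h ≤ n/2` and every real `α`,
`Σ_{y < 2^{n−h}} ‖Σ_{x < 2^h} λ(2^h y + x) e(α (2^h y + x))‖ ≤ ε 2ⁿ` — the Liouville function twisted by any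
linear phase has cancellation in almost all ALIGNED dyadic blocks of every length `2^h ≥ 2^{h₀}`, uniformly in
`α` and in `h`. From MRT 2015 Thm 1.3 (PROVED in the tree, `Tao2016.MatomakiRadziwillTao2015_theorem13_holds`) by
`stub_integral_window_eq_sum` + `stub_window_average` with `T = ⌊2^h/M⌋`, `M ≍ 1/ε`.
[cite: MatomakiRadziwillTao2015, Theorem 1.3] -/
theorem stub_alignedMRT :
    ∀ ε : ℝ, 0 < ε → ∃ h₀ : ℕ, ∀ᶠ n : ℕ in atTop, ∀ h : ℕ, h₀ ≤ h → 2 * h ≤ n → ∀ α : ℝ,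
      ∑ y ∈ range (2 ^ (n - h)),
          ‖∑ x ∈ range (2 ^ h), ((ArithmeticFunction.liouville (2 ^ h * y + x) : ℤ) : ℂ) *
              Literature.NumberTheory.LFunctions.VdC.e (α * ((2 ^ h * y + x : ℕ) : ℝ))‖ ≤ ε * 2 ^ n := by
  intro ε hε
  obtain ⟨C, hC⟩ := Tao2016.MatomakiRadziwillTao2015_theorem13_holds
  -- constants: `C' = max C 1`, `M = ⌈8/ε⌉ + 1`, `η = ε / (16 M C')`
  obtain ⟨C', hC'1, hCC'⟩ : ∃ C' : ℝ, 1 ≤ C' ∧ C ≤ C' := ⟨max C 1, le_max_right _ _, le_max_left _ _⟩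
  have hC'0 : 0 < C' := lt_of_lt_of_le one_pos hC'1
  obtain ⟨M, hM1, hM8⟩ : ∃ M : ℕ, 1 ≤ M ∧ 8 / ε ≤ (M : ℝ) := by
    refine ⟨⌈8 / ε⌉₊ + 1, Nat.le_add_left _ _, ?_⟩
    have := Nat.le_ceil (8 / ε)
    push_cast; linarith
  have hM0 : (0 : ℝ) < M := by exact_mod_cast hM1
  obtain ⟨η, hηdef⟩ : ∃ η : ℝ, η = ε / (16 * M * C') := ⟨_, rfl⟩
  have hη : 0 < η := by rw [hηdef]; positivity
  obtain ⟨h₁, hh₁⟩ := exists_loglog_div_log_le hη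
  refine ⟨max h₁ (max 4 (M + 1)), ?_⟩
  filter_upwards [eventually_inv_log_rpow_le hη] with n hn h hh0 h2n α
  -- unpack the thresholds on `h`
  have hh1 : h₁ ≤ h := le_trans (le_max_left _ _) hh0
  have hh4 : 4 ≤ h := le_trans ((le_max_left _ _).trans (le_max_right _ _)) hh0
  have hhM : M + 1 ≤ h := le_trans ((le_max_right _ _).trans (le_max_right _ _)) hh0
  have hhn : h ≤ n := by omega
  -- `H = 2^h`, `Y = 2^{n-h}`, `H Y = 2^n`
  obtain ⟨H, hHdef⟩ : ∃ H : ℕ, H = 2 ^ h := ⟨_, rfl⟩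
  obtain ⟨Y, hYdef⟩ : ∃ Y : ℕ, Y = 2 ^ (n - h) := ⟨_, rfl⟩
  have hHY : H * Y = 2 ^ n := by
    rw [hHdef, hYdef, ← pow_add, Nat.add_sub_cancel' hhn]
  have hH2M : 2 * M ≤ H := by
    have h2 : 2 ^ (M + 1) ≤ 2 ^ h := Nat.pow_le_pow_right (by norm_num) hhM
    have h3 : M < 2 ^ M := Nat.lt_two_pow_self
    have : 2 * M ≤ 2 ^ (M + 1) := by rw [pow_succ]; omega
    rw [hHdef]; omega
  have hHM : M ≤ H := by omega
  have hH16 : 16 ≤ H :=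
    hHdef ▸ le_trans (by norm_num : 16 ≤ 2 ^ 4) (Nat.pow_le_pow_right (by norm_num) hh4)
  have hHY' : H ≤ Y := by
    rw [hHdef, hYdef]; exact Nat.pow_le_pow_right (by norm_num) (by omega)
  have hY0 : 0 < Y := by rw [hYdef]; positivity
  have hH0 : (0 : ℝ) < H := by exact_mod_cast (lt_of_lt_of_le (by norm_num) hH16)
  -- rewrite the statement in terms of `H`, `Y`
  rw [← hYdef, ← hHdef]
  -- the summands as a sequence `c`
  set c : ℕ → ℂ := fun m => ((ArithmeticFunction.liouville m : ℤ) : ℂ) * VdC.e (α * m) with hcdef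
  have hc : ∀ m, ‖c m‖ ≤ 1 := fun m => norm_liouville_mul_e_le α m
  -- the blocks are the window sums `V_{Hy}`
  have hblock : ∀ y : ℕ, ∑ x ∈ range H,
      ((ArithmeticFunction.liouville (H * y + x) : ℤ) : ℂ) * VdC.e (α * ((H * y + x : ℕ) : ℝ)) =
      ∑ m ∈ Ico (H * y) (H * y + H), c m := by
    intro y
    rw [Finset.sum_Ico_eq_sum_range, Nat.add_sub_cancel_left]
  simp_rw [hblock]
  -- split off the block `y = 0`
  rw [Finset.range_eq_Ico, Finset.sum_eq_sum_Ico_succ_bot hY0, zero_add]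
  -- the averaging length `T = ⌊H / M⌋`
  obtain ⟨T, hTdef⟩ : ∃ T : ℕ, T = H / M := ⟨_, rfl⟩
  have hT0 : 0 < T := hTdef ▸ Nat.div_pos hHM (by omega)
  have hTH : T ≤ H := hTdef ▸ Nat.div_le_self _ _
  have hT0' : (0 : ℝ) < T := by exact_mod_cast hT0
  have hTup : (T : ℝ) * M ≤ H := by rw [hTdef]; exact_mod_cast Nat.div_mul_le_self H M
  have hTlow : (H : ℝ) ≤ M * T + M := by
    have h1 := Nat.div_add_mod H M
    have hmod := Nat.mod_lt H (show 0 < M by omega)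
    have : H ≤ M * (H / M) + M := by omega
    rw [hTdef]; exact_mod_cast this
  -- (1) block 0
  have h0 : ‖∑ m ∈ Ico (H * 0) (H * 0 + H), c m‖ ≤ H := by
    simpa using norm_sum_Ico_le_length hc 0 H
  -- (2) aligned blocks against all windows
  have h2 := stub_window_average c hc (Y := Y) hT0 hTH
  -- (3) windows = the MRT integral
  have h3 := stub_integral_window_eq_sum c H (H * Y)
  -- (4) MRT
  have hHX : (H : ℝ) ≤ ((H * Y : ℕ) : ℝ) := by
    have : H ≤ H * Y := Nat.le_mul_of_pos_right _ hY0
    exact_mod_cast this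
  have hH10 : (10 : ℝ) ≤ H := by exact_mod_cast (le_trans (by norm_num) hH16)
  have h4 := hC (H : ℝ) ((H * Y : ℕ) : ℝ) hH10 hHX α
  rw [h3] at h4
  -- the quantity `δ`
  obtain ⟨δ, hδdef⟩ : ∃ δ : ℝ, δ = Real.log (Real.log (H : ℝ)) / Real.log (H : ℝ) +
    1 / Real.log ((H * Y : ℕ) : ℝ) ^ (1 / 700 : ℝ) := ⟨_, rfl⟩
  rw [← hδdef] at h4
  have hδ1 : Real.log (Real.log (H : ℝ)) / Real.log (H : ℝ) ≤ η := by
    have := hh₁ h hh1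
    rw [hHdef]; push_cast; exact this
  have hδ2 : 1 / Real.log ((H * Y : ℕ) : ℝ) ^ (1 / 700 : ℝ) ≤ η := by
    rw [hHY]; push_cast; exact hn
  have hlogH : 1 ≤ Real.log (H : ℝ) := by
    have h16 : (16 : ℝ) ≤ H := by exact_mod_cast hH16
    have he : Real.exp 1 ≤ (H : ℝ) := le_trans (by
      have := Real.exp_one_lt_d9; norm_num at this ⊢; linarith) h16
    simpa using Real.log_le_log (Real.exp_pos 1) he
  have hδ0 : 0 ≤ δ := by
    have a1 : 0 ≤ Real.log (Real.log (H : ℝ)) / Real.log (H : ℝ) :=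
      div_nonneg (Real.log_nonneg hlogH) (by linarith)
    have a2 : 0 ≤ 1 / Real.log ((H * Y : ℕ) : ℝ) ^ (1 / 700 : ℝ) := by
      apply div_nonneg zero_le_one
      apply Real.rpow_nonneg
      apply Real.log_nonneg
      exact_mod_cast Nat.one_le_iff_ne_zero.2 (by positivity)
    linarith
  have hδ : δ ≤ 2 * η := by linarith
  -- the MRT bound with `C'` in place of `C`
  have h4' : ∑ a ∈ Icc 1 (H * Y), ‖∑ m ∈ Ico a (a + H), c m‖ ≤ C' * δ * H * ((H * Y : ℕ) : ℝ) := by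
    refine h4.trans ?_
    have hnn : 0 ≤ δ * H * ((H * Y : ℕ) : ℝ) := by positivity
    nlinarith
  -- assemble
  have hXeq : ((H * Y : ℕ) : ℝ) = (2 : ℝ) ^ n := by rw [hHY]; push_cast; ring
  rw [← hXeq]
  have hHsq : (H : ℝ) * H ≤ ((H * Y : ℕ) : ℝ) := by exact_mod_cast Nat.mul_le_mul_left H hHY'
  have hXHY : ((H * Y : ℕ) : ℝ) = (H : ℝ) * Y := by push_cast; ring
  exact final_bound hε hC'1 hM0 hM8 hH0 hT0' hTup hTlow (by exact_mod_cast hH2M) hHsq hXHY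
    (Nat.cast_nonneg _) hηdef hδ0 hδ h0 h2 h4'

end Summit.QuantumAdvantage.DigitPolyUniformity.SketchLAR

end
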